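import Literature.Combinatorics.Sahi2008.Functional
import HarnessLib

/-!
# Sahi's `E_n` with all arguments but one mutually independent: a closed form for every `n`

Topic `Literature/Combinatorics/Sahi2008` (companion of `Functional.lean`, same vocabulary: finite type `α`,
weight `μ : α → ℝ`, expectation `ex μ`, Sahi's functional `sahiE μ n F` for `F : Fin n → α → ℝ` defined by
the Lieb–Sahi recursion [LiebSahi2021, Prop. 3.3], FKG probability weights `IsFKGMeasure`).

## The theorem (all `n`; everything here is PROVED, no named facts)

Let `F : Fin (n+2) → α → ℝ` and a slot `s`.  Suppose the functions OFF slot `s` have multiplicative joint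
moments under `μ`: `E(Π_{j∈S} F_j) = Π_{j∈S} E(F_j)` for every finite `S ∌ s` (for indicator functions of
events under a probability weight this is mutual independence of the events `F_j`, `j ≠ s`; the function
`F_s` is ARBITRARY).  Then

* `sahiE_eq_of_indepMoments`:
  `E_{n+2}(F) = (n+1)!·E(Π_j F_j) − n!·Σ_{j ≠ s} E(F_j)·E(Π_{l ≠ j} F_l)`
  (the product with slot `j` deleted is written `Π_l (update F j 1) l`; see
  `prod_update_one_eq_prod_erase`);
* `sahiE_eq_sum_cov_of_indepMoments`: equivalently `E_{n+2}(F) = n!·Σ_{j ≠ s} Cov(F_j, Π_{l≠j} F_l)`,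
  a sum of `n + 1` TWO-function covariances;
* `sahiE_nonneg_of_indepMoments`: hence `E_{n+2}(F) ≥ 0` as soon as each `F_j` (`j ≠ s`) is positively
  correlated with the product of the others;
* `sahiE_nonneg_of_indepMoments_of_isFKGMeasure`: in particular on a finite distributive lattice with an
  FKG probability weight, for nonnegative monotone `F_j` (Mathlib's two-function `fkg` supplies the
  covariances; products of nonnegative monotone functions are nonnegative monotone).  So Sahi's positivity
  `E_m ≥ 0` [Sahi2008, Conj. 5; LiebSahi2021, Conj. 1.1 — OPEN in general for every `m ≥ 3`, see the status
  block of `Functional.lean`] HOLDS, for EVERY order `m`, on the class "all functions but one mutually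
  independent" — a class different from Sahi's cumulations [Sahi2008, Thm. 2] and from the nested/chain
  classes [LiebSahi2021, Lemma 3.2];
* `sahiE_eq_zero_of_indepMoments`: if ALL the `F_j` have multiplicative joint moments then `E_{n+2}(F) = 0`
  (extends `E_m(1,…,1) = 0` [Sahi2008, Thm. 6], `sahiE_const_one`, from constants to independent families);
* `sahiE_two_eq_indepShape`: the (hypothesis-free) case of two functions in the same shape.

The cases `m = 3, 4` for events under a measure are `Literature.Probability.LatticeModels.sahiE3_eq_of_indep`
/ `sahiE4_eq_of_indep₃` (`Literature/Probability/LatticeModels/SahiIndependentAtoms.lean`).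

## Proof

Induction on `n` along the defining recursion `E_{n+2}(F) = Σ_i E_{n+1}(tail F with slot i multiplied by
F_0) − E_{n+1}(tail F)·E(F_0)`, keeping the slot `s` of the arbitrary function free, so that NO symmetry of
`E_n` is used: if `s = 0` every summand has its arbitrary function in the merged slot `i`
(`indepMoments_congr_off`, `indepMoments_tail_of_zero`) and `E_{n+1}(tail F) = 0` (all of `tail F`
independent); if `s = k+1` the summand `i = k` has the arbitrary function `F_{k+1}·F_0` in slot `k`, the
summands `i ≠ k` keep it in slot `k` — merging the independent head `F_0` into an independent slot preserves
multiplicativity of the moments off `k` (`indepMoments_merge`) — and the extra terms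
`E(F_0)E(F_{i+1})·E(Π_{l ∉ {0,i+1}} F_l)` they produce cancel against `−E_{n+1}(tail F)·E(F_0)`.  The printed
route to the same identity is Lieb–Sahi's cycle bookkeeping [LiebSahi2021, Prop. 3.4] together with
`E_m(1,…,1) = 0` for `m ≥ 2` [Sahi2008, Thm. 6]; the identity itself we have not found stated in print (it
was observed in this project's exact census of `E_4` on percolation events, 2026-08-19, and checked here in
exact arithmetic for `n ≤ 5` before the proof). [folklore]

## Not here

Symmetry / multilinearity of `E_n` (`Sahi2008/Symmetry.lean`, another seat); the product-measure
specialisation (events determined by disjoint coordinate sets are independent: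
`Literature.Probability.LatticeModels.prodBernoulli_real_inter_of_determinedBy_disjoint`) is done for
`m = 3, 4` in `Literature/Probability/LatticeModels/SahiIndependentAtoms.lean` and is immediate for general
`m` from `sahiE_nonneg_of_indepMoments` once a bridge `sahiE ↔ measure` is in the tree (`Sahi2008/Percolation.lean`,
another seat).
-/

namespace Literature.Combinatorics.Sahi2008

open Finset Function

/-! ### Products of families with one slot modified (pointwise products of functions `α → ℝ`) -/

section ProductHelpers

variable {α : Type*}

/-- Merging a factor `h` into slot `i` multiplies the full product by `h`. [folklore] -/
theorem prod_update_mul_eq {m : ℕ} (g : Fin m → α → ℝ) (i : Fin m) (h : α → ℝ) :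
    ∏ j, update g i (g i * h) j = h * ∏ j, g j := by
  rw [prod_update_of_mem (mem_univ i), sdiff_singleton_eq_erase, ← mul_prod_erase univ g (mem_univ i)]
  ring

/-- After merging `h` into slot `i`, deleting a different slot `j` still leaves the factor `h`. [folklore] -/
theorem prod_update_update_one_of_ne {m : ℕ} (g : Fin m → α → ℝ) {i j : Fin m} (hji : j ≠ i)
    (h : α → ℝ) : ∏ l, update (update g i (g i * h)) j 1 l = h * ∏ l, update g j 1 l := by
  rw [update_comm (Ne.symm hji)]
  have hg : g i = update g j (1 : α → ℝ) i := (update_of_ne (Ne.symm hji) _ _).symm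
  conv_lhs => rw [hg]
  exact prod_update_mul_eq (update g j 1) i h

/-- Deleting the merged slot itself forgets the merged factor. [folklore] -/
theorem prod_update_update_one_self {m : ℕ} (g : Fin m → α → ℝ) (i : Fin m) (b : α → ℝ) :
    ∏ l, update (update g i b) i 1 l = ∏ l, update g i 1 l := by
  rw [update_idem]

/-- Deleting slot `j+1` of `F` = `F 0` times deleting slot `j` of `tail F`. [folklore] -/
theorem prod_update_succ_one {n : ℕ} (F : Fin (n + 1) → α → ℝ) (j : Fin n) :
    ∏ l, update F j.succ 1 l = F 0 * ∏ i, update (Fin.tail F) j 1 i := by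
  rw [Fin.prod_univ_succ, update_of_ne (Fin.succ_ne_zero j).symm]
  congr 1
  refine prod_congr rfl fun i _ => ?_
  show Fin.tail (update F j.succ 1) i = _
  rw [Fin.tail_update_succ]

/-- Deleting slot `0` of `F` leaves the product of `tail F`. [folklore] -/
theorem prod_update_zero_one {n : ℕ} (F : Fin (n + 1) → α → ℝ) :
    ∏ l, update F 0 1 l = ∏ i, Fin.tail F i := by
  rw [Fin.prod_univ_succ, update_self, one_mul]
  exact prod_congr rfl fun i _ => update_of_ne (Fin.succ_ne_zero i) _ _

/-- The full product of `F` is `F 0` times the product of `tail F`. [folklore] -/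
theorem prod_eq_head_mul_prod_tail {n : ℕ} (F : Fin (n + 1) → α → ℝ) :
    ∏ l, F l = F 0 * ∏ i, Fin.tail F i :=
  Fin.prod_univ_succ F

/-- The product with slot `j` set to `1` is the product over the other slots. [folklore] -/
theorem prod_update_one_eq_prod_erase {m : ℕ} (F : Fin m → α → ℝ) (j : Fin m) :
    ∏ l, update F j 1 l = ∏ l ∈ univ.erase j, F l := by
  rw [prod_update_of_mem (mem_univ j), one_mul, sdiff_singleton_eq_erase]

/-- Slot `j` times the product of the other slots is the full product. [folklore] -/
theorem mul_prod_update_one {m : ℕ} (F : Fin m → α → ℝ) (j : Fin m) :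
    F j * ∏ l, update F j 1 l = ∏ l, F l := by
  rw [prod_update_one_eq_prod_erase, mul_prod_erase univ F (mem_univ j)]

end ProductHelpers

/-! ### Sums over all slots but one -/

section SumHelpers

/-- `Σ_i Σ_{j ≠ i} c_j = (m − 1)·Σ_j c_j` on `Fin (n+2)` (`m = n + 2`). [folklore] -/
theorem sum_sum_erase_eq {n : ℕ} (c : Fin (n + 2) → ℝ) :
    ∑ i, ∑ j ∈ univ.erase i, c j = (n + 1 : ℝ) * ∑ j, c j := by
  have h : ∀ i : Fin (n + 2), ∑ j ∈ univ.erase i, c j = (∑ j, c j) - c i := fun i =>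
    sum_erase_eq_sub (mem_univ i)
  simp only [h, sum_sub_distrib, sum_const, card_univ, Fintype.card_fin, nsmul_eq_mul]
  push_cast
  ring

/-- `Σ_{j ≠ 0} d_j = Σ_i d_{i+1}` on `Fin (n+1)`. [folklore] -/
theorem sum_erase_zero_eq {n : ℕ} (d : Fin (n + 1) → ℝ) :
    ∑ j ∈ univ.erase 0, d j = ∑ i : Fin n, d i.succ := by
  rw [sum_erase_eq_sub (mem_univ _), Fin.sum_univ_succ]
  ring

/-- `Σ_{j ≠ k+1} d_j = d_0 + Σ_{i ≠ k} d_{i+1}` on `Fin (n+1)`. [folklore] -/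
theorem sum_erase_succ_eq {n : ℕ} (d : Fin (n + 1) → ℝ) (k : Fin n) :
    ∑ j ∈ univ.erase k.succ, d j = d 0 + ∑ i ∈ univ.erase k, d i.succ := by
  rw [sum_erase_eq_sub (mem_univ _), sum_erase_eq_sub (mem_univ _), Fin.sum_univ_succ]
  ring

/-- A sum whose summand differs from `c` only at `i ∈ s`. [folklore] -/
theorem sum_eq_sum_sub_add {ι : Type*} [DecidableEq ι] {s : Finset ι} {i : ι} (hi : i ∈ s)
    (g c : ι → ℝ) (hg : ∀ j ∈ s, j ≠ i → g j = c j) :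
    ∑ j ∈ s, g j = (∑ j ∈ s, c j) - c i + g i := by
  rw [← add_sum_erase s g hi, ← add_sum_erase s c hi,
    sum_congr rfl fun j hj => hg j (mem_of_mem_erase hj) (ne_of_mem_erase hj)]
  ring

end SumHelpers

/-! ### Transport of the hypothesis "multiplicative moments off one slot" along the recursion -/

section Main

variable {α : Type*} [Fintype α]

/-- If the arbitrary slot is `0`, all of `tail F` has multiplicative moments. [folklore] -/
theorem indepMoments_tail_of_zero {n : ℕ} {μ : α → ℝ} {F : Fin (n + 1) → α → ℝ}
    (hF : ∀ S : Finset (Fin (n + 1)), (0 : Fin (n + 1)) ∉ S →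
      ex μ (∏ j ∈ S, F j) = ∏ j ∈ S, ex μ (F j))
    (S : Finset (Fin n)) : ex μ (∏ j ∈ S, Fin.tail F j) = ∏ j ∈ S, ex μ (Fin.tail F j) := by
  have h0 : (0 : Fin (n + 1)) ∉ S.map (Fin.succEmb n) := by
    intro h
    obtain ⟨j, -, hj⟩ := mem_map.1 h
    rw [Fin.coe_succEmb] at hj
    exact Fin.succ_ne_zero j hj
  have h := hF _ h0
  rw [prod_map, prod_map] at h
  exact h

/-- If the arbitrary slot is `k+1`, `tail F` has multiplicative moments off `k`. [folklore] -/
theorem indepMoments_tail_of_succ {n : ℕ} {μ : α → ℝ} {F : Fin (n + 1) → α → ℝ} {k : Fin n}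
    (hF : ∀ S : Finset (Fin (n + 1)), k.succ ∉ S → ex μ (∏ j ∈ S, F j) = ∏ j ∈ S, ex μ (F j))
    (S : Finset (Fin n)) (hS : k ∉ S) :
    ex μ (∏ j ∈ S, Fin.tail F j) = ∏ j ∈ S, ex μ (Fin.tail F j) := by
  have h0 : k.succ ∉ S.map (Fin.succEmb n) := by
    intro h
    obtain ⟨j, hj, hjk⟩ := mem_map.1 h
    rw [Fin.coe_succEmb] at hjk
    have hjk' : j = k := Fin.succ_inj.1 hjk
    exact hS (hjk' ▸ hj)
  have h := hF _ h0
  rw [prod_map, prod_map] at h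
  exact h

/-- The hypothesis only sees the family off the arbitrary slot. [folklore] -/
theorem indepMoments_congr_off {m : ℕ} {μ : α → ℝ} {G G' : Fin m → α → ℝ} {i : Fin m}
    (hGG' : ∀ j, j ≠ i → G' j = G j)
    (hG : ∀ S : Finset (Fin m), i ∉ S → ex μ (∏ j ∈ S, G j) = ∏ j ∈ S, ex μ (G j))
    (S : Finset (Fin m)) (hS : i ∉ S) :
    ex μ (∏ j ∈ S, G' j) = ∏ j ∈ S, ex μ (G' j) := by
  have hne : ∀ j ∈ S, j ≠ i := fun j hj h => hS (h ▸ hj)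
  rw [prod_congr rfl fun j hj => hGG' j (hne j hj),
    prod_congr rfl fun j hj => congrArg (ex μ) (hGG' j (hne j hj))]
  exact hG S hS

/-- Merging the independent head `F 0` into an independent slot `i ≠ k` keeps the moments off `k`
multiplicative. [folklore] -/
theorem indepMoments_merge {n : ℕ} {μ : α → ℝ} {F : Fin (n + 1) → α → ℝ} {k i : Fin n} (hik : i ≠ k)
    (hF : ∀ S : Finset (Fin (n + 1)), k.succ ∉ S → ex μ (∏ j ∈ S, F j) = ∏ j ∈ S, ex μ (F j))
    (S : Finset (Fin n)) (hS : k ∉ S) :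
    ex μ (∏ j ∈ S, update (Fin.tail F) i (Fin.tail F i * F 0) j) =
      ∏ j ∈ S, ex μ (update (Fin.tail F) i (Fin.tail F i * F 0) j) := by
  by_cases hi : i ∈ S
  · rw [prod_update_of_mem hi, sdiff_singleton_eq_erase]
    have hrhs : ∏ j ∈ S, ex μ (update (Fin.tail F) i (Fin.tail F i * F 0) j) =
        ex μ (Fin.tail F i * F 0) * ∏ j ∈ S.erase i, ex μ (Fin.tail F j) := by
      rw [prod_congr rfl fun j _ =>
          Function.apply_update (fun _ => ex μ) (Fin.tail F) i (Fin.tail F i * F 0) j,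
        prod_update_of_mem hi, sdiff_singleton_eq_erase]
    rw [hrhs]
    -- the pair {i+1, 0}
    have hpair : ex μ (Fin.tail F i * F 0) = ex μ (Fin.tail F i) * ex μ (F 0) := by
      have hmem : k.succ ∉ ({i.succ, 0} : Finset (Fin (n + 1))) := by
        simp only [mem_insert, mem_singleton, not_or]
        exact ⟨fun h => hik (Fin.succ_inj.1 h).symm, Fin.succ_ne_zero k⟩
      have h := hF _ hmem
      rw [prod_pair (Fin.succ_ne_zero i), prod_pair (Fin.succ_ne_zero i)] at h
      exact h
    -- the set insert 0 (S.map succ)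
    have h0 : (0 : Fin (n + 1)) ∉ S.map (Fin.succEmb n) := by
      intro h
      obtain ⟨j, -, hj⟩ := mem_map.1 h
      rw [Fin.coe_succEmb] at hj
      exact Fin.succ_ne_zero j hj
    have hmem : k.succ ∉ insert (0 : Fin (n + 1)) (S.map (Fin.succEmb n)) := by
      rw [mem_insert, not_or]
      refine ⟨Fin.succ_ne_zero k, fun h => ?_⟩
      obtain ⟨j, hj, hjk⟩ := mem_map.1 h
      rw [Fin.coe_succEmb] at hjk
      have hjk' : j = k := Fin.succ_inj.1 hjk
      exact hS (hjk' ▸ hj)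
    have hbig := hF _ hmem
    rw [prod_insert h0, prod_insert h0, prod_map, prod_map,
      ← mul_prod_erase S (fun j => F ((Fin.succEmb n) j)) hi,
      ← mul_prod_erase S (fun j => ex μ (F ((Fin.succEmb n) j))) hi] at hbig
    have e1 : Fin.tail F i * F 0 * ∏ j ∈ S.erase i, Fin.tail F j =
        F 0 * (F ((Fin.succEmb n) i) * ∏ j ∈ S.erase i, F ((Fin.succEmb n) j)) := by
      simp only [Fin.coe_succEmb, Fin.tail]
      ring
    have e2 : ∏ j ∈ S.erase i, ex μ (Fin.tail F j) =
        ∏ j ∈ S.erase i, ex μ (F ((Fin.succEmb n) j)) := by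
      simp only [Fin.coe_succEmb, Fin.tail]
    have e3 : ex μ (Fin.tail F i) = ex μ (F ((Fin.succEmb n) i)) := by
      simp only [Fin.coe_succEmb, Fin.tail]
    rw [e1, hbig, hpair, e2, e3]
    ring
  · rw [prod_update_of_notMem hi]
    rw [prod_congr rfl fun j hj =>
      (congrArg (ex μ) (update_of_ne (ne_of_mem_of_not_mem hj hi) _ _) :
        ex μ (update (Fin.tail F) i (Fin.tail F i * F 0) j) = ex μ (Fin.tail F j))]
    exact indepMoments_tail_of_succ hF S hS

/-! ### The theorem -/

/-- The case of two functions (no hypothesis needed): `E_2(F) = E(F_0 F_1) − E(F_0)E(F_1)` in the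
shape of `sahiE_eq_of_indepMoments`. [cite: LiebSahi2021, eq. (1.1)] -/
theorem sahiE_two_eq_indepShape (μ : α → ℝ) (F : Fin 2 → α → ℝ) (s : Fin 2) :
    sahiE μ 2 F =
      ((0 + 1).factorial : ℝ) * ex μ (∏ j, F j) -
        ((0 : ℕ).factorial : ℝ) * ∑ j ∈ univ.erase s, ex μ (F j) * ex μ (∏ l, update F j 1 l) := by
  have u01 : update F 0 (1 : α → ℝ) 1 = F 1 := update_of_ne (by decide) _ _
  have u10 : update F 1 (1 : α → ℝ) 0 = F 0 := update_of_ne (by decide) _ _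
  rw [sahiE_two_apply]
  fin_cases s
  · simp only [Fin.zero_eta, Fin.isValue, sum_erase_eq_sub (mem_univ _), Fin.sum_univ_two,
      Fin.prod_univ_two, update_self, u01, u10, Nat.zero_add, Nat.factorial_one, Nat.factorial_zero,
      Nat.cast_one, one_mul, mul_one]
    ring
  · simp only [Fin.mk_one, Fin.isValue, sum_erase_eq_sub (mem_univ _), Fin.sum_univ_two,
      Fin.prod_univ_two, update_self, u01, u10, Nat.zero_add, Nat.factorial_one, Nat.factorial_zero,
      Nat.cast_one, one_mul, mul_one]
    ring

/-- **Sahi's `E_n` with all arguments but one mutually independent.**  For `F : Fin (n+2) → α → ℝ` and a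
slot `s` such that the functions off `s` have multiplicative joint moments under the weight `μ`
(`E(Π_{j∈S} F_j) = Π_{j∈S} E(F_j)` for every `S ∌ s`; `F_s` arbitrary),
`E_{n+2}(F) = (n+1)!·E(Π_j F_j) − n!·Σ_{j ≠ s} E(F_j)·E(Π_{l ≠ j} F_l)`
(the product with slot `j` deleted is written `Π_l (update F j 1) l`).  Proof by induction along the
Lieb–Sahi recursion, see the module docstring; the printed ingredients are [LiebSahi2021, Prop. 3.3/3.4] and
`E_m(1,…,1) = 0` [Sahi2008, Thm. 6]. [folklore] -/
theorem sahiE_eq_of_indepMoments (μ : α → ℝ) (n : ℕ) (F : Fin (n + 2) → α → ℝ) (s : Fin (n + 2))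
    (hF : ∀ S : Finset (Fin (n + 2)), s ∉ S → ex μ (∏ j ∈ S, F j) = ∏ j ∈ S, ex μ (F j)) :
    sahiE μ (n + 2) F =
      ((n + 1).factorial : ℝ) * ex μ (∏ j, F j) -
        (n.factorial : ℝ) * ∑ j ∈ univ.erase s, ex μ (F j) * ex μ (∏ l, update F j 1 l) := by
  induction n with
  | zero => exact sahiE_two_eq_indepShape μ F s
  | succ n ih =>
    rw [sahiE_succ_succ μ (n + 1) F]
    -- facts about the merged families `G i = update (tail F) i (tail F i * F 0)`
    have hprodG : ∀ i : Fin (n + 2),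
        ∏ j, update (Fin.tail F) i (Fin.tail F i * F 0) j = ∏ l, F l := fun i => by
      rw [prod_update_mul_eq, prod_eq_head_mul_prod_tail F]
    have hR : ∀ i j : Fin (n + 2), j ≠ i →
        ∏ l, update (update (Fin.tail F) i (Fin.tail F i * F 0)) j 1 l = ∏ l, update F j.succ 1 l :=
      fun i j hji => by
      rw [prod_update_update_one_of_ne (Fin.tail F) hji, prod_update_succ_one F j]
    have hGj : ∀ i j : Fin (n + 2), j ≠ i →
        update (Fin.tail F) i (Fin.tail F i * F 0) j = F j.succ := fun i j hji => by
      rw [update_of_ne hji]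
      rfl
    -- the inner sums produced by the induction hypothesis, off the merged slot
    have hinner : ∀ i : Fin (n + 2), ∀ s' : Fin (n + 2), ∀ j ∈ univ.erase s', j ≠ i →
        ex μ (update (Fin.tail F) i (Fin.tail F i * F 0) j) *
            ex μ (∏ l, update (update (Fin.tail F) i (Fin.tail F i * F 0)) j 1 l) =
          ex μ (F j.succ) * ex μ (∏ l, update F j.succ 1 l) := by
      intro i s' j _ hji
      rw [hGj i j hji, hR i j hji]
    rcases Fin.eq_zero_or_eq_succ s with rfl | ⟨k, rfl⟩
    · -- Case `s = 0`: the head is the arbitrary function, `tail F` is fully multiplicative.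
      have hTall : ∀ S : Finset (Fin (n + 2)),
          ex μ (∏ j ∈ S, Fin.tail F j) = ∏ j ∈ S, ex μ (Fin.tail F j) :=
        indepMoments_tail_of_zero hF
      have hIH : ∀ i : Fin (n + 2),
          sahiE μ (n + 2) (update (Fin.tail F) i (Fin.tail F i * F 0)) =
            ((n + 1).factorial : ℝ) * ex μ (∏ l, F l) -
              (n.factorial : ℝ) *
                ∑ j ∈ univ.erase i, ex μ (F j.succ) * ex μ (∏ l, update F j.succ 1 l) := by
        intro i
        have hyp : ∀ S : Finset (Fin (n + 2)), i ∉ S →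
            ex μ (∏ j ∈ S, update (Fin.tail F) i (Fin.tail F i * F 0) j) =
              ∏ j ∈ S, ex μ (update (Fin.tail F) i (Fin.tail F i * F 0) j) :=
          indepMoments_congr_off (fun j hj => hGj i j hj ▸ rfl) (fun S _ => hTall S)
        rw [ih _ i hyp, hprodG i, sum_congr rfl fun j hj => hinner i i j hj (ne_of_mem_erase hj)]
      have hT0 : sahiE μ (n + 2) (Fin.tail F) = 0 := by
        rw [ih (Fin.tail F) 0 fun S _ => hTall S]
        have h1 : ex μ (∏ j, Fin.tail F j) = ∏ j, ex μ (Fin.tail F j) := hTall univ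
        have h2 : ∀ j : Fin (n + 2), ex μ (Fin.tail F j) * ex μ (∏ l, update (Fin.tail F) j 1 l) =
            ∏ l, ex μ (Fin.tail F l) := by
          intro j
          rw [prod_update_of_mem (mem_univ j), one_mul, sdiff_singleton_eq_erase, hTall,
            mul_prod_erase univ (fun l => ex μ (Fin.tail F l)) (mem_univ j)]
        have hcard : (univ.erase (0 : Fin (n + 2))).card = n + 1 := by
          rw [card_erase_of_mem (mem_univ _), card_univ, Fintype.card_fin]
          omega
        rw [h1, sum_congr rfl fun j _ => h2 j, sum_const, hcard, nsmul_eq_mul, Nat.factorial_succ]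
        push_cast
        ring
      rw [sum_congr rfl fun i _ => hIH i, hT0, zero_mul, sub_zero, sum_sub_distrib, sum_const, card_univ,
        Fintype.card_fin, ← mul_sum, sum_sum_erase_eq, sum_erase_zero_eq, nsmul_eq_mul]
      simp only [Nat.factorial_succ]
      push_cast
      ring
    · -- Case `s = k+1`: the head `F 0` is one of the independent functions.
      have hTk : ∀ S : Finset (Fin (n + 2)), k ∉ S →
          ex μ (∏ j ∈ S, Fin.tail F j) = ∏ j ∈ S, ex μ (Fin.tail F j) :=
        indepMoments_tail_of_succ hF
      have hpair : ∀ i : Fin (n + 2), i ≠ k →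
          ex μ (Fin.tail F i * F 0) = ex μ (Fin.tail F i) * ex μ (F 0) := by
        intro i hik
        have hmem : k.succ ∉ ({i.succ, 0} : Finset (Fin (n + 1 + 2))) := by
          simp only [mem_insert, mem_singleton, not_or]
          exact ⟨fun h => hik (Fin.succ_inj.1 h).symm, Fin.succ_ne_zero k⟩
        have h := hF _ hmem
        rw [prod_pair (Fin.succ_ne_zero i), prod_pair (Fin.succ_ne_zero i)] at h
        exact h
      -- summand i = k: arbitrary function `tail F k * F 0` in slot k
      have hk_term :
          sahiE μ (n + 2) (update (Fin.tail F) k (Fin.tail F k * F 0)) =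
            ((n + 1).factorial : ℝ) * ex μ (∏ l, F l) -
              (n.factorial : ℝ) *
                ∑ j ∈ univ.erase k, ex μ (F j.succ) * ex μ (∏ l, update F j.succ 1 l) := by
        have hyp : ∀ S : Finset (Fin (n + 2)), k ∉ S →
            ex μ (∏ j ∈ S, update (Fin.tail F) k (Fin.tail F k * F 0) j) =
              ∏ j ∈ S, ex μ (update (Fin.tail F) k (Fin.tail F k * F 0) j) :=
          indepMoments_congr_off (fun j hj => hGj k j hj ▸ rfl) hTk
        rw [ih _ k hyp, hprodG k, sum_congr rfl fun j hj => hinner k k j hj (ne_of_mem_erase hj)]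
      -- summands i ≠ k: arbitrary function stays in slot k
      have hi_term : ∀ i ∈ univ.erase k,
          sahiE μ (n + 2) (update (Fin.tail F) i (Fin.tail F i * F 0)) =
            ((n + 1).factorial : ℝ) * ex μ (∏ l, F l) -
              (n.factorial : ℝ) *
                ((∑ j ∈ univ.erase k, ex μ (F j.succ) * ex μ (∏ l, update F j.succ 1 l)) -
                  ex μ (F i.succ) * ex μ (∏ l, update F i.succ 1 l) +
                  ex μ (F 0) * (ex μ (Fin.tail F i) * ex μ (∏ l, update (Fin.tail F) i 1 l))) := by
        intro i hi
        have hik : i ≠ k := ne_of_mem_erase hi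
        have hyp : ∀ S : Finset (Fin (n + 2)), k ∉ S →
            ex μ (∏ j ∈ S, update (Fin.tail F) i (Fin.tail F i * F 0) j) =
              ∏ j ∈ S, ex μ (update (Fin.tail F) i (Fin.tail F i * F 0) j) :=
          indepMoments_merge hik hF
        rw [ih _ k hyp, hprodG i,
          sum_eq_sum_sub_add hi
            (fun j => ex μ (update (Fin.tail F) i (Fin.tail F i * F 0) j) *
              ex μ (∏ l, update (update (Fin.tail F) i (Fin.tail F i * F 0)) j 1 l))
            (fun j => ex μ (F j.succ) * ex μ (∏ l, update F j.succ 1 l))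
            (fun j hj hji => hinner i k j hj hji)]
        simp only [update_self, prod_update_update_one_self, hpair i hik]
        ring
      -- the subtracted term: `tail F` with arbitrary slot k
      have hT_term : sahiE μ (n + 2) (Fin.tail F) =
          ((n + 1).factorial : ℝ) * ex μ (∏ l, Fin.tail F l) -
            (n.factorial : ℝ) *
              ∑ j ∈ univ.erase k, ex μ (Fin.tail F j) * ex μ (∏ l, update (Fin.tail F) j 1 l) :=
        ih (Fin.tail F) k hTk
      have hcard : (univ.erase k).card = n + 1 := by
        rw [card_erase_of_mem (mem_univ _), card_univ, Fintype.card_fin]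
        omega
      rw [← add_sum_erase univ _ (mem_univ k), hk_term, sum_congr rfl hi_term, hT_term,
        sum_erase_succ_eq _ k, prod_update_zero_one F]
      simp only [sum_sub_distrib, sum_add_distrib, sum_const, hcard, ← mul_sum, nsmul_eq_mul,
        Nat.factorial_succ]
      push_cast
      ring

/-! ### Consequences: covariance form, positivity, the fully independent case -/

/-- **Covariance form**: under the hypothesis of `sahiE_eq_of_indepMoments`,
`E_{n+2}(F) = n!·Σ_{j ≠ s} (E(F_j·Π_{l≠j} F_l) − E(F_j)·E(Π_{l≠j} F_l))`, a sum of `n + 1` two-function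
covariances. [folklore] -/
theorem sahiE_eq_sum_cov_of_indepMoments (μ : α → ℝ) (n : ℕ) (F : Fin (n + 2) → α → ℝ)
    (s : Fin (n + 2))
    (hF : ∀ S : Finset (Fin (n + 2)), s ∉ S → ex μ (∏ j ∈ S, F j) = ∏ j ∈ S, ex μ (F j)) :
    sahiE μ (n + 2) F =
      (n.factorial : ℝ) * ∑ j ∈ univ.erase s,
        (ex μ (F j * ∏ l, update F j 1 l) - ex μ (F j) * ex μ (∏ l, update F j 1 l)) := by
  have hsum : ∑ j ∈ univ.erase s, ex μ (F j * ∏ l, update F j 1 l) =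
      ∑ j ∈ univ.erase s, ex μ (∏ l, F l) :=
    sum_congr rfl fun j _ => by rw [mul_prod_update_one]
  have hcard : (univ.erase s).card = n + 1 := by
    rw [card_erase_of_mem (mem_univ _), card_univ, Fintype.card_fin]
    omega
  rw [sahiE_eq_of_indepMoments μ n F s hF, sum_sub_distrib, hsum, sum_const, hcard, nsmul_eq_mul,
    Nat.factorial_succ]
  push_cast
  ring

/-- **Positivity from `n + 1` two-function inequalities**: if the functions off slot `s` have
multiplicative moments and each `F_j` (`j ≠ s`) is positively correlated with the product of the others,
then `E_{n+2}(F) ≥ 0`. [folklore] -/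
theorem sahiE_nonneg_of_indepMoments (μ : α → ℝ) (n : ℕ) (F : Fin (n + 2) → α → ℝ) (s : Fin (n + 2))
    (hF : ∀ S : Finset (Fin (n + 2)), s ∉ S → ex μ (∏ j ∈ S, F j) = ∏ j ∈ S, ex μ (F j))
    (hcov : ∀ j, j ≠ s →
      ex μ (F j) * ex μ (∏ l, update F j 1 l) ≤ ex μ (F j * ∏ l, update F j 1 l)) :
    0 ≤ sahiE μ (n + 2) F := by
  rw [sahiE_eq_sum_cov_of_indepMoments μ n F s hF]
  exact mul_nonneg (Nat.cast_nonneg _)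
    (sum_nonneg fun j hj => sub_nonneg.2 (hcov j (ne_of_mem_erase hj)))

/-- **Sahi positivity on the class "all but one mutually independent", every order, every FKG weight.**
On a finite distributive lattice with an FKG probability weight `μ` (`IsFKGMeasure μ`), if
`F_0,…,F_{n+1}` are nonnegative and monotone and the functions off one slot `s` have multiplicative joint
moments, then `E_{n+2}(F) ≥ 0` — by `sahiE_nonneg_of_indepMoments` and the two-function FKG inequality
(Mathlib's `fkg`) applied to `F_j` and `Π_{l≠j} F_l`.  (Sahi's conjecture asks this for ALL nonnegative
monotone families [Sahi2008, Conj. 5]; here only the independent class is covered.) [folklore] -/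
theorem sahiE_nonneg_of_indepMoments_of_isFKGMeasure [DistribLattice α] {μ : α → ℝ}
    (hμ : IsFKGMeasure μ) (n : ℕ) (F : Fin (n + 2) → α → ℝ) (s : Fin (n + 2))
    (hF : ∀ S : Finset (Fin (n + 2)), s ∉ S → ex μ (∏ j ∈ S, F j) = ∏ j ∈ S, ex μ (F j))
    (hF₀ : ∀ j x, 0 ≤ F j x) (hmono : ∀ j, Monotone (F j)) : 0 ≤ sahiE μ (n + 2) F := by
  refine sahiE_nonneg_of_indepMoments μ n F s hF fun j _ => ?_
  have key : Monotone (∏ l, update F j 1 l) ∧ ∀ x, 0 ≤ (∏ l, update F j 1 l) x := by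
    refine Finset.prod_induction _ (fun f : α → ℝ => Monotone f ∧ ∀ x, 0 ≤ f x) ?_ ?_ ?_
    · rintro f g ⟨hf, hf0⟩ ⟨hg, hg0⟩
      exact ⟨hf.mul hg hf0 hg0, fun x => mul_nonneg (hf0 x) (hg0 x)⟩
    · exact ⟨monotone_const, fun _ => zero_le_one⟩
    · intro l _
      rcases eq_or_ne l j with rfl | hlj
      · rw [update_self]
        exact ⟨monotone_const, fun _ => zero_le_one⟩
      · rw [update_of_ne hlj]
        exact ⟨hmono l, hF₀ l⟩
  have h := fkg (F j) (∏ l, update F j 1 l) μ (fun x => hμ.nonneg x) (fun x => hF₀ j x)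
    (fun x => key.2 x) (hmono j) key.1 hμ.mul_le_mul
  rw [hμ.sum_eq_one, one_mul] at h
  simpa only [ex, Pi.mul_apply] using h

/-- **All arguments mutually independent ⇒ `E_{n+2} = 0`** (every covariance in the covariance form
vanishes); this extends `E_n(1,…,1) = 0` [Sahi2008, Thm. 6] from constants to independent families.
[folklore] -/
theorem sahiE_eq_zero_of_indepMoments (μ : α → ℝ) (n : ℕ) (F : Fin (n + 2) → α → ℝ)
    (hF : ∀ S : Finset (Fin (n + 2)), ex μ (∏ j ∈ S, F j) = ∏ j ∈ S, ex μ (F j)) :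
    sahiE μ (n + 2) F = 0 := by
  rw [sahiE_eq_sum_cov_of_indepMoments μ n F 0 fun S _ => hF S]
  have h : ∀ j : Fin (n + 2),
      ex μ (F j * ∏ l, update F j 1 l) - ex μ (F j) * ex μ (∏ l, update F j 1 l) = 0 := by
    intro j
    rw [mul_prod_update_one, prod_update_one_eq_prod_erase, hF univ, hF (univ.erase j),
      mul_prod_erase univ (fun l => ex μ (F l)) (mem_univ j), sub_self]
  rw [sum_congr rfl fun j _ => h j, sum_const_zero, mul_zero]

end Main

end Literature.Combinatorics.Sahi2008
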